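import Literature.Computability.AlgebraicComplexity.GeneralisedGrenetMatrix
import Literature.Computability.AlgebraicComplexity.GrenetPencilOrbitProportional
import Summits.ValiantsHypothesis.ValiantsHypothesis.Theorems.ProjectionStabilityUniqStepStubLrEqualityNormalForm

/-! # Crux `UniqStep` (stmt-ValiantsHypothesis-17834), line `Sketch` — stub `stub_orbitProportional`:
# the level forms of a left-equivariant generalised Grenet matrix are proportional

WHAT. For `N ≥ 3` and `m + 1 = 2^N`, let `G(a, e)` be a GENERALISED GRENET MATRIX (Grenet's
`(univ, ∅)` minor of `1 - adj` for the branching program on the subsets of `Fin N`, labelled along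
`e : Finset (Fin N) ≃ Fin (m + 1)`, sign `(-1)^(e univ + e ∅)`, in which the arc `S → insert k S`
carries the linear form `∑_c a S k c · x_{k,c}`).  If `G(a, e)` is an affine determinantal
representation of `per_N` equivariant (exact lifts) for the left monomial symmetries
`leftMonomialSubst ℂ N`, then the forms of one level are proportional:
`a S k c = ρ S k · α |S| c` for `k ∉ S`.

Proof. The pencil `Λ = G(0) = ε · (partial identity)`, `A_{kc} = coeffMat G (k, c)` (supported on
the arcs, coefficient `-ε · a S k c` on `S → S ∪ {k}`) is Grenet-shaped in the sense of
`GrenetPencilCanonicalSubspaces.lean`; by `exists_torusData` (stub S3's file) it carries a one-sided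
torus datum with `dim ker Λ = 1`, an injective member and an exact lift of every row permutation.
`LRPencil.exists_level_factorisation` (`GrenetPencilOrbitProportional.lean`) then gives the
factorisation: the canonical subspaces are the up-set coordinate subspaces (canonical newness from
the count of LR17 §6), the permutation lifts permute them and are therefore triangular with
non-zero diagonal coefficients, and reading `B A_{kc} = A_{σk, c} C` on `e_{S ∪ {k}}` at the row
`σ S` shows that the forms of `(S, k)` and `(σ S, σ k)` are proportional; `𝔖_N` is transitive on
the arcs of a level.

WHY. Fourth step of `UniqStep_of` (line `Sketch`): after the bet (L-symmetry of an optimal honest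
projection) and S3 (`stub_lrEqualityNormalForm`: `⊥`-equivalence to some `G(a, e)` with
`det = per_N`, again L-equivariant), this stub makes the level forms proportional, and S5
(`stub_gradedRigidity`) turns a proportional `G(a, e)` with `det = per_N` into Grenet's matrix up to
gauge and a right monomial substitution.

SOURCE. J. M. Landsberg, N. Ressayre, *Permanent v. determinant: an exponential lower bound
assuming symmetry and a potential path towards Valiant's conjecture*, Differential Geom. Appl. 55
(2017), Thm. 2.8 and §6 (key `LandsbergRessayre2017`); B. Grenet (2011), Thm. 1 (key
`Grenet2011`); folklore (the equality case).
-/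

-- D-0017 layout: Sub = Summit for this single-conjunct summit, so the namespace repeats a component.
set_option linter.dupNamespace false

namespace Summit.ValiantsHypothesis.ValiantsHypothesis.Theorems.ProjectionStabilityUniqStep

open MvPolynomial
open scoped BigOperators Matrix
open Literature.Computability.AlgebraicComplexity LRPencil Grenet

noncomputable section

/-- **STUB S4** of line `Sketch` of crux `UniqStep` — the equality case of Landsberg–Ressayre
Thm. 2.8, symmetry half: if the generalised Grenet matrix `G(a, e)` (`N ≥ 3`, `m + 1 = 2^N`; the
arc `S → insert k S` carries `∑_c a S k c · x_{k,c}`) is a left-monomially-equivariant affine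
determinantal representation of `per_N`, then the linear forms of one level are proportional:
`a S k c = ρ S k · α |S| c` for all `k ∉ S`. [cite: LandsbergRessayre2017, Thm. 2.8] -/
theorem stub_orbitProportional :
    ∀ (N m : ℕ), 3 ≤ N → m + 1 = 2 ^ N →
      ∀ (e : Finset (Fin N) ≃ Fin (m + 1)) (a : Finset (Fin N) → Fin N → Fin N → ℂ),
        IsEquivariantDetRepr (leftMonomialSubst ℂ N) (perPoly (Fin N) ℂ)
          ((-1 : MvPolynomial (Fin N × Fin N) ℂ) ^ ((e Finset.univ : ℕ) + (e ∅ : ℕ)) •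
            (((1 - Matrix.of fun S T : Finset (Fin N) => ∑ k : Fin N, if k ∉ S ∧ T = insert k S
                then ∑ c : Fin N, a S k c • (X (k, c) : MvPolynomial (Fin N × Fin N) ℂ)
                else 0).submatrix e.symm e.symm).submatrix
              (Fin.succAbove (e Finset.univ)) (Fin.succAbove (e ∅)))) →
        ∃ (ρ : Finset (Fin N) → Fin N → ℂ) (α : ℕ → Fin N → ℂ),
          ∀ (S : Finset (Fin N)) (k c : Fin N), k ∉ S → a S k c = ρ S k * α S.card c := by
  intro N m hN _ e a hG
  classical
  -- the generalised Grenet matrix and the entries of its pencil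
  set s : ℕ := (e Finset.univ : ℕ) + (e ∅ : ℕ) with hs
  set G : Matrix (Fin m) (Fin m) (MvPolynomial (Fin N × Fin N) ℂ) :=
    (-1 : MvPolynomial (Fin N × Fin N) ℂ) ^ s •
      (((1 - Matrix.of fun S T : Finset (Fin N) => ∑ k : Fin N, if k ∉ S ∧ T = insert k S
          then ∑ c : Fin N, a S k c • (X (k, c) : MvPolynomial (Fin N × Fin N) ℂ)
          else 0).submatrix e.symm e.symm).submatrix
        (Fin.succAbove (e Finset.univ)) (Fin.succAbove (e ∅))) with hGdef
  have hMa : ∀ S T : Finset (Fin N),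
      (Matrix.of fun S T : Finset (Fin N) => ∑ k : Fin N, if k ∉ S ∧ T = insert k S
        then ∑ c : Fin N, a S k c • (X (k, c) : MvPolynomial (Fin N × Fin N) ℂ) else 0) S T =
      ∑ k : Fin N, if k ∉ S ∧ T = insert k S
        then ∑ c : Fin N, a S k c • (X (k, c) : MvPolynomial (Fin N × Fin N) ℂ) else 0 :=
    fun S T => rfl
  have hΛ : ∀ i j : Fin m, constPart G i j =
      if e.symm ((e Finset.univ).succAbove i) = e.symm ((e ∅).succAbove j)
        then (-1 : ℂ) ^ s else 0 := by
    intro i j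
    simp only [hGdef, constPart_apply, Matrix.smul_apply, Matrix.submatrix_apply, smul_eq_mul]
    rw [neg_one_pow_eq_C, map_mul, constantCoeff_C, constantCoeff_one_sub_arc hMa]
    split_ifs
    · rw [mul_one]
    · rw [mul_zero]
  have hA : ∀ (p q : Fin N) (i j : Fin m), coeffMat G (p, q) i j =
      if p ∉ e.symm ((e Finset.univ).succAbove i) ∧
          e.symm ((e ∅).succAbove j) = insert p (e.symm ((e Finset.univ).succAbove i))
        then -((-1 : ℂ) ^ s * a (e.symm ((e Finset.univ).succAbove i)) p q) else 0 := by
    intro p q i j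
    simp only [hGdef, coeffMat_apply, Matrix.smul_apply, Matrix.submatrix_apply, smul_eq_mul]
    rw [neg_one_pow_eq_C, coeff_C_mul, coeff_one_sub_arc hMa]
    split_ifs
    · rw [mul_neg]
    · rw [neg_zero, mul_zero]
  -- the torus datum of the left-equivariant representation `G(a, e)` of `per_N`
  obtain ⟨D, hDΛ, hDA, hK, hgen, hperm⟩ := exists_torusData hN hG
  have hε : ((-1 : ℂ) ^ s) ≠ 0 := pow_ne_zero _ (neg_ne_zero.2 one_ne_zero)
  -- the level factorisation of the arc coefficients `-ε · a S k c`
  obtain ⟨ρ, α, h⟩ := exists_level_factorisation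
    (b := fun S p q => -((-1 : ℂ) ^ s * a S p q)) (Λm := constPart G)
    (Am := fun p q => coeffMat G (p, q))
    (rowSet_injective e) (rowSet_ne_univ e) (fun S hS => exists_rowSet_eq e hS)
    (colSet_injective e) (colSet_ne_empty e) (fun T hT => exists_colSet_eq e hT)
    hε hΛ hA D hDΛ hDA hK hgen hperm
  refine ⟨fun S k => -(((-1 : ℂ) ^ s)⁻¹ * ρ S k), α, fun S k c hk => ?_⟩
  have h1 := h S k c hk
  calc a S k c = ((-1 : ℂ) ^ s)⁻¹ * ((-1 : ℂ) ^ s * a S k c) := by rw [inv_mul_cancel_left₀ hε]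
    _ = ((-1 : ℂ) ^ s)⁻¹ * (-(ρ S k * α S.card c)) := by rw [← h1, neg_neg]
    _ = -(((-1 : ℂ) ^ s)⁻¹ * ρ S k) * α S.card c := by ring

end

end Summit.ValiantsHypothesis.ValiantsHypothesis.Theorems.ProjectionStabilityUniqStep
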